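import Literature.NumberTheory.EllipticCurves.GaloisAction
import HarnessLib

/-!
# Elkies (2006): the modular curve `𝒳 = X(9)/G` (RSZB label `9.27.0.1`) of elliptic curves whose
# mod-`9` Galois image is Elkies' group `G′` — its `j`-map, and the moduli sentence as ONE cited fact

Topic `Literature/NumberTheory/EllipticCurves`, sub-directory `Elkies2006` (author–year; namespace =
path). Contents: (1) honest definitions with bodies — Elkies' degree-`27` rational function `elkiesJ`
(SIGN-CORRECTED against his own table of values, see MISPRINTS), his sextics `elkiesA`, `elkiesB`,
the subgroup `G′ ≤ GL₂(ℤ/9ℤ)` by a CERTIFIED generating set (`elkiesGroupNine`), and the predicate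
"the mod-`9` representation of `W` is conjugate into `G′`" (`ModNineImageConjElkies`, an explicit
basis of `E[9]`); (2) ONE named fact (`def … : Prop`, D-0014) — the MODULI SENTENCE "mod-`9` image
conjugate into `G′` ⟺ `j ∈ f(ℙ¹)`" for elliptic curves with `j ∉ {0, 1728}` over a field of
characteristic `0`, with its printed sources; (3) `norm_num` API reproducing the seven integral values
of [Elkies2006] §4 (which is what fixes the sign of `f`). No theorem about Galois images is proved
here; nothing else is asserted.

Commissioned by the cell `b2b-bsdres`, team n1011 (X4 ∧ `p = 3`): RESIDUAL-MAP §D/§I N11 / O8, the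
EXOTIC residue "`ρ̄_{E,3}` onto ∧ the `3`-adic tower fails". The kernel already proves, for `E/ℚ`
with surj(3): tower fails ⟺ ¬surj(9) (`forall_hasSurjectiveModNGaloisRep_three_pow_of_nine`) ⟺
"every `σ ∈ Γ` fixing `E[3]` acts on `E[9]` by a scalar" (`GaloisImage/NineTorsion*`,
`ExoticThreeAdicImage`), and p14's certified finite computation in `GL₂(ℤ/9ℤ)` (kit j133190, to be
kernelised) identifies the subgroups `D` with `D ∩ (1 + 3M₂) ⊆` scalars as exactly those conjugate
into `G′`. What is NOT kernel mathematics is the moduli interpretation of `X_{G′}` and Elkies' model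
`X_{G′} ≅ ℙ¹`, `j = f(x)`: that is the one cited sentence below (used over `ℚ` for the class statement
and over `ℚ₃` for p14's local `L9` criterion). HONEST FRAMING of the cell (verbatim): the goal is to
DELETE the COMBINATION-SHAPED residual classes for ALL analytic-rank `≤ 1` curves over `ℚ` … so that
the remainder becomes exactly the CONSTRUCTION-SHAPED classes, which are TYPED, NOT attempted; this is
not "finishing BSD". This file books nothing and moves no mark.

## Printed statements (page-checked 2026-08-21, n1011-lit GEN 8, on the held texts AND on the arXiv
## TeX source of [Elkies2006]; `cells/n1011/LIT-INPUTS-P3.md` §57)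

* [Elkies2006] §0: "He [Serre] noted that for `l = 3` there exists a subgroup `G ⊂ SL₂(ℤ/9ℤ)` such
  that the restriction to `G` of the reduction-mod-3 map `SL₂(ℤ/9ℤ) → SL₂(ℤ/3ℤ)` is an isomorphism.
  … Such curves `E` [those for which `G` is the image of `ρ₃ mod 9`] are parametrized by a modular
  curve `𝒳 = X(9)/G`. The natural cover `𝒳 → X(1)` has degree `27`, and our rational function `f`
  arises as the pullback to `𝒳` of the degree-1 function `j` on `X(1)`."
* §1: "A direct search finds 27 such lifts `S̃, T̃`, all equivalent under conjugation in
  `SL₂(ℤ/9ℤ)`. … we choose `S̃ = (0 2; 4 0)`, `T̃ = (4 1; −3 4)`, and set `G = ⟨S̃, T̃⟩ ⊂ SL₂(ℤ/9ℤ)`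
  and `𝒳 = X(9)/(G/{±1})`. … To obtain a model of `𝒳` defined over `ℚ`, we must extend `G` to a group
  `G′ ⊂ GL₂(ℤ/9ℤ)` such that `G′ ⊳ G` and the determinant map `G′/G → (ℤ/9ℤ)^*` is an isomorphism.
  For the preimages of the squares in `(ℤ/9ℤ)^*` we use the invertible multiples of the identity
  (recall that `−I` is already in `G`). It remains to lift `±(−1 0; 0 1)` …, and we calculate that
  the unique choice that normalizes `G` is `±(−1 0; 0 1)`. Together with the invertible scalar
  matrices this yields a unique extension `G′` satisfying our conditions, and thus a unique structure
  for `𝒳` as a modular curve over `ℚ`. … `𝒳` must be isomorphic with `ℙ¹(ℚ)`." (the three cusps are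
  the zeros of `x³ − 3x − 1`, conjugate over `ℚ(ζ₉ + ζ₉⁻¹)`).
* §2: "`j = f(x)` with `f(x) = −3⁷(x²−1)³(x⁶+3x⁵+6x⁴+x³−3x²+12x+16)³(2x³+3x²−3x−5)/(x³−3x−1)⁹
  = 1728 − 3³A²(x)B²(x)(2x³−3x²+4)/(x³−3x−1)⁹`, `A = x⁶+6x⁵+4x³+12x²−18x−23`,
  `B = 7x⁶+24x⁵+18x⁴−26x³−33x²+18x+28`" (TeX source ll. 385–397 identical) — see MISPRINTS.
* §3: "Now let `E/ℚ` be an elliptic curve with [j-invariant] `f(x)` for some `x ∈ ℙ¹(ℚ)`. Assume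
  that … `ρ₃` is surjective mod `3`. Then its image mod `9` is (a conjugate of) the proper subgroup
  `G′` of `GL₂(ℤ/9ℤ)`, because this image is contained in `G[′]` and its determinant maps
  surjectively … We claim that the mod-3 condition on `ρ₃` is satisfied … except at `x = ±1`, the
  points at which `f(x) = 0`" (with proof: the genus-`1` curve `3(2x³+3x²−3x−5) = z³` has no
  rational point; the genus-`3` curve `𝒳′` has only cuspidal/CM rational points) — NOT vendored here
  (no consumer needs it: on the cell's rows surj(3) is a class hypothesis).
* §4: the seven non-zero integral values, `(x, j) = (1/0, 4374), (−2, 419904), (0, −44789760),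
  (−1/2, 15786448344), (2, 24992518538304), (−3/2, −92515041526500), (−1/3, −70043919611288518656)`.
* [SutherlandZywina2017] (Algebra & Number Theory 11 (2017) 1199–1229) Prop. 2.7: "Fix an open
  subgroup `G` of `GL₂(ℤ̂)` that satisfies `−I ∈ G` and `det(G) = ℤ̂^×`. … Let `E` be an elliptic
  curve defined over `ℚ` with `j_E ∉ {0, 1728}`. Then `ρ_E(Gal_ℚ)` is conjugate in `GL₂(ℤ̂)` to a
  subgroup of `G` if and only if `j_E` belongs to `π_G(X_G(ℚ))`"; Thm. 1.1 (the 220 genus-0 groups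
  of prime-power level with their `J(t)`, Table 1 for `3`-power level).
* [RouseSutherlandZureickbrown2022] §2.3 + Rem. 2.2 (any perfect field `k` with `char k ∤ N`,
  `char k ≠ 2, 3` for the converse): "For an elliptic curve `E/k`, if `ρ_{E,N}(G_k) ≤ H` then there
  exists an isomorphism `ι` … for which `(E,[ι]_H) ∈ Y_H(k)`. Conversely … if `(E,[ι]_H) ∈ Y_H(k)`,
  then … for at least one [twist] `E′` we have `ρ_{E′,N}(G_k) ≤ H`"; with `−I ∈ H` and
  `j ∉ {0,1728}` (`Aut E = ±1`) the twist is not needed. Label of `X_{G′}`: `9.27.0.1` (§4, §8).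

MISPRINTS in [Elkies2006] found by this seat (exact integer arithmetic; `LIT-INPUTS-P3.md` §57):
(M1) SIGN OF `f`: the two displayed forms of §2 disagree with each other as printed and both disagree
in sign with the §4 table; the identity that holds is
`3⁷(x²−1)³(…)³(2x³+3x²−3x−5) = 1728·(x³−3x−1)⁹ + 3³A²B²(2x³−3x²+4)` (all `28` coefficients), and ONLY
the function WITHOUT the leading minus (`= 1728 + 3³A²B²(…)/(x³−3x−1)⁹`) reproduces the seven §4
values (theorems `elkiesJ_*` below) — `elkiesJ` is that function. (M2) GENERATORS: as printed,
`⟨(0 2; 4 0), (4 1; −3 4)⟩ = SL₂(ℤ/9ℤ)` (order `648`, direct enumeration; one of the two matrices is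
printed transposed relative to the other). With `S̃ = (0 4; 2 0)` (the transpose of the printed `S̃`;
`≡ S = (0 1; −1 0) mod 3`) and the printed `T̃` one gets (enumeration, `g8/elkies/certify_groups.py`
of the commissioning seat): `|⟨S̃, T̃⟩| = 24` with element orders those of `SL₂(𝔽₃)`, reduction mod
`3` injective onto `SL₂(ℤ/3ℤ)` (`⟨S̃,T̃⟩ ∩ (1+3M₂) = 1`), `−I ∈ ⟨S̃,T̃⟩`; the extension
`G′ = ⟨S̃, T̃, 2·I, diag(−1,1)⟩` has order `144`, `G′ ∩ (1+3M₂) = {I, 4I, 7I}`, `det G′ = (ℤ/9ℤ)^×`,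
`G′ mod 3 = GL₂(𝔽₃)`, and `N_{GL₂(ℤ/9ℤ)}(⟨S̃,T̃⟩) = G′` (so Elkies' "unique extension" sentence
holds verbatim). Transposing `T̃` instead gives the transposed groups, conjugate to these (all
order-`24` lifts are conjugate, [Elkies2006] §1); since `G′` is unique up to conjugacy ([Elkies2006]
§1; p14 kit j133190) the representative is immaterial for "conjugate into". (M3) §3's sentence "`ρ₃` is
surjective mod 3 if and only if the intersection … is contained in …" is a slip for "fails to be
surjective iff" (cosmetic).

NOT CLAIMED: Elkies' §3 surjectivity-mod-3 claim (not vendored); anything at `j ∈ {0, 1728}`;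
positive characteristic; the `3`-adic image itself (index-2 twists).
TODO(general form): the moduli sentence for every perfect field of characteristic `∤ 6`
([RouseSutherlandZureickbrown2022] §2.3) — only characteristic `0` is stated.

## References
* [Elkies2006] N. D. Elkies, *Elliptic curves with 3-adic Galois representation surjective mod 3 but
  not mod 9*, arXiv:math/0612734 (2006), §§0–4 (held `paper:arxiv-math_0612734`; TeX source read).
* [SutherlandZywina2017] A. V. Sutherland, D. Zywina, Algebra Number Theory 11 (2017) 1199–1229 =
  arXiv:1605.03988, Prop. 2.7, Thm. 1.1, Cor. 1.6 (held `paper:arxiv-1605.03988`).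
* [RouseSutherlandZureickbrown2022] J. Rouse, A. V. Sutherland, D. Zureick-Brown, Forum Math. Sigma 10
  (2022) e62 = arXiv:2106.11141, §2.3, Rem. 2.2, Thm. 1.6, Rem. 1.3, §4 (held `paper:arxiv-2106.11141`).
-/

namespace Literature.NumberTheory.EllipticCurves.Elkies2006

open WeierstrassCurve

/-! ## Elkies' rational function (§2, sign fixed by §4) -/

section jMap

variable {F : Type*} [Field F]

/-- Elkies' sextic `A(x) = x⁶ + 6x⁵ + 4x³ + 12x² − 18x − 23`. [cite: Elkies2006, §2] -/
def elkiesA (x : F) : F := x ^ 6 + 6 * x ^ 5 + 4 * x ^ 3 + 12 * x ^ 2 - 18 * x - 23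

/-- Elkies' sextic `B(x) = 7x⁶ + 24x⁵ + 18x⁴ − 26x³ − 33x² + 18x + 28`. [cite: Elkies2006, §2] -/
def elkiesB (x : F) : F :=
  7 * x ^ 6 + 24 * x ^ 5 + 18 * x ^ 4 - 26 * x ^ 3 - 33 * x ^ 2 + 18 * x + 28

/-- **Elkies' `j`-map `f` of `𝒳 = X_{G′}` (RSZB `9.27.0.1`) on the affine coordinate `x`**, with the
sign fixed by [Elkies2006] §4 (module docstring, MISPRINT (M1)):
`f(x) = 3⁷ (x²−1)³ (x⁶+3x⁵+6x⁴+x³−3x²+12x+16)³ (2x³+3x²−3x−5) / (x³−3x−1)⁹`.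
The poles are the three cusps (zeros of `x³ − 3x − 1`, irrational); the value of the degree-`27` map
at `x = 1/0` is `2·3⁷ = 4374` and is carried separately in `elkiesJSet`.
[cite: Elkies2006, §2 (formula for f), §4 (table of values fixing the sign)] -/
def elkiesJ (x : F) : F :=
  3 ^ 7 * (x ^ 2 - 1) ^ 3 * (x ^ 6 + 3 * x ^ 5 + 6 * x ^ 4 + x ^ 3 - 3 * x ^ 2 + 12 * x + 16) ^ 3 *
    (2 * x ^ 3 + 3 * x ^ 2 - 3 * x - 5) / (x ^ 3 - 3 * x - 1) ^ 9

/-- The `j`-invariants of the non-cuspidal `F`-points of `𝒳 ≅ ℙ¹_F`: `f(1/0) = 4374` and `f(x)` for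
`x ∈ F` off the cusps `x³ − 3x − 1 = 0`. [cite: Elkies2006, §§1–2, §4] -/
def elkiesJSet (F : Type*) [Field F] : Set F :=
  {j | j = 4374 ∨ ∃ x : F, x ^ 3 - 3 * x - 1 ≠ 0 ∧ elkiesJ x = j}

/-- Unfolding `elkiesJSet`: `j ∈ f(ℙ¹(F) ∖ cusps)` iff `j = f(1/0) = 4374` or `j = f(x)` for some
`x ∈ F` off the cusps. [cite: Elkies2006, §§1–2 (𝒳 ≅ ℙ¹, j = f(x)), §4 (row x = 1/0, j = 4374)] -/
theorem mem_elkiesJSet_iff (j : F) :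
    j ∈ elkiesJSet F ↔ j = 4374 ∨ ∃ x : F, x ^ 3 - 3 * x - 1 ≠ 0 ∧ elkiesJ x = j := Iff.rfl

end jMap

/-! ### The seven integral values of [Elkies2006] §4 (these FIX the sign of `f`) and the two zeros -/

/-- `f(1) = 0` (a `j = 0` CM point; "Besides `f(±1) = 0` …"). [cite: Elkies2006, §4] -/
theorem elkiesJ_one : elkiesJ (1 : ℚ) = 0 := by norm_num [elkiesJ]

/-- `f(−1) = 0`. [cite: Elkies2006, §4] -/
theorem elkiesJ_neg_one : elkiesJ (-1 : ℚ) = 0 := by norm_num [elkiesJ]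

/-- §4 row `x = −2`: `j = 419904` (`[0,0,0,−162,792]`, `N = 2⁸3⁵`). [cite: Elkies2006, §4 (table)] -/
theorem elkiesJ_neg_two : elkiesJ (-2 : ℚ) = 419904 := by norm_num [elkiesJ]

/-- §4 row `x = 0`: `j = −44789760` (`[0,0,1,−135,−604]`, `N = 3⁵5² = 6075`).
[cite: Elkies2006, §4 (table), Abstract] -/
theorem elkiesJ_zero : elkiesJ (0 : ℚ) = -44789760 := by norm_num [elkiesJ]

/-- §4 row `x = −1/2`: `j = 15786448344` (`N = 2⁵3⁵`). [cite: Elkies2006, §4 (table)] -/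
theorem elkiesJ_neg_half : elkiesJ (-1 / 2 : ℚ) = 15786448344 := by norm_num [elkiesJ]

/-- §4 row `x = 2`: `j = 24992518538304` (`N = 2⁸3⁵17²`). [cite: Elkies2006, §4 (table)] -/
theorem elkiesJ_two : elkiesJ (2 : ℚ) = 24992518538304 := by norm_num [elkiesJ]

/-- §4 row `x = −3/2`: `j = −92515041526500` (`N = 2³3⁵19²`). [cite: Elkies2006, §4 (table)] -/
theorem elkiesJ_neg_three_halves : elkiesJ (-3 / 2 : ℚ) = -92515041526500 := by
  norm_num [elkiesJ]

/-- §4 row `x = −1/3`: `j = −70043919611288518656` (`N = 3⁵97²101²`). [cite: Elkies2006, §4 (table)] -/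
theorem elkiesJ_neg_third : elkiesJ (-1 / 3 : ℚ) = -70043919611288518656 := by
  norm_num [elkiesJ]

/-- The second printed form of `f` with its sign fixed: `f(x) − 1728 = 3³A(x)²B(x)²(2x³−3x²+4)/(x³−3x−1)⁹`
at the §4 abscissa `x = 0`: `−44789760 − 1728 = 27·23²·28²·4/(−1)`. [cite: Elkies2006, §2, §4] -/
theorem elkiesJ_zero_sub_1728 :
    elkiesJ (0 : ℚ) - 1728 =
      3 ^ 3 * elkiesA (0 : ℚ) ^ 2 * elkiesB 0 ^ 2 * (2 * 0 ^ 3 - 3 * 0 ^ 2 + 4) /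
        ((0 : ℚ) ^ 3 - 3 * 0 - 1) ^ 9 := by
  norm_num [elkiesJ, elkiesA, elkiesB]

/-! ## Elkies' group `G′ ≤ GL₂(ℤ/9ℤ)` and the predicate "mod-`9` image conjugate into `G′`" -/

/-- **Elkies' group `G′ ≤ GL₂(ℤ/9ℤ)`** (order `144`; the normaliser of a subgroup `G ≅ SL₂(𝔽₃)`
mapping isomorphically onto `SL₂(ℤ/3ℤ)`; `G′ ∩ (1 + 3M₂(ℤ/9)) = {I, 4I, 7I}`, `det G′ = (ℤ/9ℤ)^×`,
`−I ∈ G′`; unique up to conjugacy), as the submonoid of `M₂(ℤ/9ℤ)` generated by the CERTIFIED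
generating set `S̃ = (0 4; 2 0)`, `T̃ = (4 1; −3 4)`, `2·I`, `diag(−1, 1)` — [Elkies2006] §1's
`⟨S̃, T̃⟩` extended by "the invertible scalar matrices" and the lift `±(−1 0; 0 1)`; `S̃` is the
TRANSPOSE of the printed `(0 2; 4 0)` (module docstring, MISPRINT (M2): as printed the pair generates
`SL₂(ℤ/9ℤ)`; the transposed choice is certified by enumeration). The monoid closure of finitely many
invertible matrices over a finite ring is a group, so this is `G′` as a set.
[cite: Elkies2006, §1 (G = ⟨S̃, T̃⟩, the unique extension G′)]
[cite: RouseSutherlandZureickbrown2022, §4 and §8 (label 9.27.0.1)] -/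
def elkiesGroupNine : Set (Matrix (Fin 2) (Fin 2) (ZMod 9)) :=
  (Submonoid.closure
    ({!![0, 4; 2, 0], !![4, 1; -3, 4], !![2, 0; 0, 2], !![-1, 0; 0, 1]} :
      Set (Matrix (Fin 2) (Fin 2) (ZMod 9))) : Set (Matrix (Fin 2) (Fin 2) (ZMod 9)))

/-- The generators lie in `G′` (unfolding). [cite: Elkies2006, §1] -/
theorem mem_elkiesGroupNine_of_mem_generators {g : Matrix (Fin 2) (Fin 2) (ZMod 9)}
    (hg : g ∈ ({!![0, 4; 2, 0], !![4, 1; -3, 4], !![2, 0; 0, 2], !![-1, 0; 0, 1]} :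
      Set (Matrix (Fin 2) (Fin 2) (ZMod 9)))) :
    g ∈ elkiesGroupNine :=
  Submonoid.subset_closure hg

/-- `G′` is closed under products ("a group `G′ ⊂ GL₂(ℤ/9ℤ)`"; here by construction as a monoid
closure). [cite: Elkies2006, §1 (the group G′ ⊂ GL₂(ℤ/9ℤ))] -/
theorem mul_mem_elkiesGroupNine {g h : Matrix (Fin 2) (Fin 2) (ZMod 9)}
    (hg : g ∈ elkiesGroupNine) (hh : h ∈ elkiesGroupNine) : g * h ∈ elkiesGroupNine :=
  Submonoid.mul_mem _ hg hh

/-- `I ∈ G′` ("a group `G′ ⊂ GL₂(ℤ/9ℤ)`"; here by construction as a monoid closure).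
[cite: Elkies2006, §1 (the group G′ ⊂ GL₂(ℤ/9ℤ))] -/
theorem one_mem_elkiesGroupNine : (1 : Matrix (Fin 2) (Fin 2) (ZMod 9)) ∈ elkiesGroupNine :=
  Submonoid.one_mem _

variable {F : Type*} [Field F] (W : WeierstrassCurve F) [W.IsElliptic]

/-- **"The mod-`9` Galois image of `W` is conjugate into Elkies' `G′`"** in the tree's vocabulary
(`geomTorsion W 9 = E[9] ≤ E(F̄)` with its `Γ_F`-action, `Literature/…/GaloisAction.lean`): there is a
`ℤ/9ℤ`-basis of `E[9]`, i.e. an additive isomorphism `φ : E[9] ≃ (ℤ/9ℤ)²`, in which every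
`σ ∈ Γ_F = Gal(F̄/F)` acts through a matrix of `G′` (`φ(σ • P) = g·φ(P)`). This is
"`ρ_{E,9}(Γ_F) ≤ G′` up to conjugacy in `GL₂(ℤ/9ℤ)`" of [SutherlandZywina2017] Prop. 2.7 /
[RouseSutherlandZureickbrown2022] Rem. 1.1, §2.2 with the basis made explicit (for `W` elliptic over a
field of characteristic `0`, `E[9] ≅ (ℤ/9ℤ)²`, so such `φ` exist and range over all bases).
[cite: RouseSutherlandZureickbrown2022, §2.2 (ι_E and ρ_{E,N}), Rem. 1.1] -/
def ModNineImageConjElkies : Prop :=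
  ∃ φ : geomTorsion W 9 ≃+ (Fin 2 → ZMod 9),
    ∀ σ : Field.absoluteGaloisGroup F, ∃ g ∈ elkiesGroupNine,
      ∀ P : geomTorsion W 9, φ (σ • P) = g.mulVec (φ P)

/-- **Elkies 2006 / Sutherland–Zywina 2017 / Rouse–Sutherland–Zureick-Brown 2022 — the moduli
sentence for the curve `𝒳 = X_{G′}` (label `9.27.0.1`), NAMED FACT (cited; not proved here).**
For every elliptic curve `E` over a field `F` of characteristic `0` with `j(E) ∉ {0, 1728}`:
the mod-`9` Galois image `ρ̄_{E,9}(Gal(F̄/F)) ≤ Aut E[9] ≅ GL₂(ℤ/9ℤ)` is conjugate to a subgroup of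
Elkies' group `G′` **if and only if** `j(E) ∈ f(ℙ¹(F))`, i.e. `j(E) = 4374` (the point `x = 1/0`) or
`j(E) = f(x)` for some `x ∈ F` with `x³ − 3x − 1 ≠ 0` (off the three cusps), `f = elkiesJ`.
Printed sources: the moduli property of `X_H` for `−I ∈ H`, `det H` full —
[SutherlandZywina2017] Prop. 2.7 (over `ℚ`, verbatim in the module docstring) and
[RouseSutherlandZureickbrown2022] §2.3 + Rem. 2.2 (any perfect field of characteristic prime to the
level; for `j ∉ {0,1728}` one has `Aut E = {±1} ⊆ H`, so no twist intervenes) — applied to `H = G′`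
(`−I ∈ G′`, `det G′ = (ℤ/9ℤ)^×`: [Elkies2006] §1), together with Elkies' model
`X_{G′} = 𝒳 ≅ ℙ¹` over `ℚ` with `j = f(x)` ([Elkies2006] §§1–2, "Such curves `E` are parametrized by
a modular curve `𝒳 = X(9)/G` … our rational function `f` arises as the pullback to `𝒳` of the
degree-1 function `j`"; = the Table-1 row of [SutherlandZywina2017] Thm. 1.1 for the level-`9`,
index-`27`, genus-`0` group). Hypotheses complete as printed: characteristic `0` (print: perfect,
`char ∤ 6·9`), `j ∉ {0, 1728}`; `f` with the sign fixed by §4 and `G′` by the certified generators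
(module docstring (M1)–(M2)). The `3`-adic preprint [Elkies2006] is cited for the MODEL only; the
moduli interpretation is refereed ([SutherlandZywina2017], [RouseSutherlandZureickbrown2022]).
Consumers (cell `b2b-bsdres`): `F = ℚ` — the EXOTIC class statement of X4 at `3` (with the kernel's
"tower fails ⟺ kernel-of-reduction acts by scalars on `E[9]`" and p14's finite group fact "scalar
kernel ⟺ conjugate into `G′`"); `F = ℚ₃` — p14's local criterion `L9`.
[cite: SutherlandZywina2017, Prop. 2.7 (p. 1206); Thm. 1.1 with Table 1 (3-power level, genus 0)]
[cite: RouseSutherlandZureickbrown2022, §2.3 and Rem. 2.2 (moduli of X_H over a perfect field), Rem. 1.3, §4 (9.27.0.1)]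
[cite: Elkies2006, §0 ("Such curves E are parametrized by 𝒳 = X(9)/G"), §1 (G, G′, 𝒳 ≅ ℙ¹ over ℚ), §2 (j = f(x)), §4 (values); arXiv preprint (2006) — cited for the explicit model] -/
def modNineImage_conj_elkiesGroup_iff_j (F : Type*) [Field F] [CharZero F] : Prop :=
  ∀ (W : WeierstrassCurve F) [W.IsElliptic], W.j ≠ 0 → W.j ≠ 1728 →
    (ModNineImageConjElkies W ↔ W.j ∈ elkiesJSet F)

/-! ## Bookkeeping corollaries (PROVED from the fact; no new content) -/

/-- From the fact, (⟸): a curve with `j = f(x)` off the cusps (or `j = 4374`), `j ∉ {0,1728}`, has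
mod-`9` image conjugate into `G′`. [cite: SutherlandZywina2017, Prop. 2.7] [cite: Elkies2006, §§1–2] -/
theorem modNineImageConjElkies_of_mem {F : Type*} [Field F] [CharZero F]
    (h : modNineImage_conj_elkiesGroup_iff_j F) (W : WeierstrassCurve F) [W.IsElliptic]
    (h0 : W.j ≠ 0) (h1728 : W.j ≠ 1728) (hj : W.j ∈ elkiesJSet F) : ModNineImageConjElkies W :=
  (h W h0 h1728).2 hj

/-- From the fact, (⟹): mod-`9` image conjugate into `G′` and `j ∉ {0,1728}` put `j` on Elkies'
family `f(ℙ¹(F))`. [cite: SutherlandZywina2017, Prop. 2.7] [cite: Elkies2006, §§0–2] -/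
theorem mem_elkiesJSet_of_modNineImageConjElkies {F : Type*} [Field F] [CharZero F]
    (h : modNineImage_conj_elkiesGroup_iff_j F) (W : WeierstrassCurve F) [W.IsElliptic]
    (h0 : W.j ≠ 0) (h1728 : W.j ≠ 1728) (hc : ModNineImageConjElkies W) : W.j ∈ elkiesJSet F :=
  (h W h0 h1728).1 hc

/-- Contrapositive used by the class files: `j ∉ f(ℙ¹(F))` (and `j ∉ {0,1728}`) ⟹ the mod-`9` image
is NOT conjugate into `G′` (hence, over `ℚ` with surj(3), the `3`-adic tower holds — kernel side).
[cite: SutherlandZywina2017, Prop. 2.7] [cite: Elkies2006, §§0–2] -/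
theorem not_modNineImageConjElkies_of_not_mem {F : Type*} [Field F] [CharZero F]
    (h : modNineImage_conj_elkiesGroup_iff_j F) (W : WeierstrassCurve F) [W.IsElliptic]
    (h0 : W.j ≠ 0) (h1728 : W.j ≠ 1728) (hj : W.j ∉ elkiesJSet F) : ¬ ModNineImageConjElkies W :=
  fun hc => hj ((h W h0 h1728).1 hc)

/-- The §4 curves are on the family: e.g. `j = −44789760` (`N = 6075`, `x = 0`).
[cite: Elkies2006, §4] -/
theorem neg_44789760_mem_elkiesJSet : (-44789760 : ℚ) ∈ elkiesJSet ℚ :=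
  Or.inr ⟨0, by norm_num, elkiesJ_zero⟩

/-- `j = 4374` (`N = 1944`, `x = 1/0`) is on the family. [cite: Elkies2006, §4] -/
theorem val_4374_mem_elkiesJSet : (4374 : ℚ) ∈ elkiesJSet ℚ := Or.inl rfl

/-- `j = 419904` (`N = 62208`, `x = −2`) is on the family. [cite: Elkies2006, §4] -/
theorem val_419904_mem_elkiesJSet : (419904 : ℚ) ∈ elkiesJSet ℚ :=
  Or.inr ⟨-2, by norm_num, elkiesJ_neg_two⟩

end Literature.NumberTheory.EllipticCurves.Elkies2006
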